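import Mathlib
import Summits.ValiantsHypothesis.ValiantsHypothesis.Theorems.BarrierLeverDefinableEquationsDefs
import Summits.ValiantsHypothesis.ValiantsHypothesis.Theorems.BarrierLeverDefinableEquationsStubSelGadget
import Summits.ValiantsHypothesis.ValiantsHypothesis.Theorems.BarrierLeverDefinableEquationsStubDatumWitness

/-!
# Crux `BarrierLever.DefinableEquations` (stmt-8745) / item `SingleSizeEquations` (stmt-8749) —
# VALIANT'S CRITERION AT SCALE `N` FOR SUCCINCT CONTRACTION SUMS (layer-2 arrow
# `ValiantCriterionAtScaleN` of the route's two-layer plan; val-np-p5 g7)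

The tree has Valiant's criterion at the coefficient scale `N = C(2n,n)` only for POLYNOMIALLY
SHORT lists of tableau contractions (`tableauSumsDefinable_pow`: `≤ N^c` terms, free complex
coefficients) and for one datum (`stub_datumWitness`).  Here: SUCCINCT sums of EXPONENTIAL length,
the form in which the route's plan (`HWVVanishesOnSlice → TableauCoordinatesSharpP →
ValiantCriterionAtScaleN`) and Chatterjee–Tengse's question (arXiv:2309.07612 §1.3, direction 2:
annihilators with `#P`-explicit coefficient functions) are phrased.

For `n`, `D` tensor blocks, `r` auxiliary ("certificate") bits and ANY polynomial `Q` in the top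
coefficient variables `X_e` (`e ∈ topMonomials n`) and the Boolean block `BPos D n ⊕ Fin r`
(one-hot positions of an index function `i : Fin D × Fin n → Fin n`, plus `r` free bits `w`), the
SUCCINCT CONTRACTION SUM of `Q` is

  `F_Q = ∑_{i : Fin D × Fin n → Fin n} ∑_{w : Fin r → Bool} Q(X; oneHot i, w) · ∏_k X_{e(i|k)}`

(`e(i|k) = expTop (i (k, ·))`): `n^{Dn} · 2^r` terms (`2^{poly(N)}` for `D, r ≤ N^c`), the
coefficient of the ordered monomial `∏_k X_{e(i|k)}` being the Boolean-cube sum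
`∑_w Q(oneHot i, w)` — a `#P`-style function of the monomial when `Q` is small (Bürgisser 2000,
Prop. 2.20).  Every top-supported form of degree `D` is some `F_Q`; the content is the size bound.

* `SuccinctContraction.exists_witness` — **`F_Q = boolSum H`**, `H` on `Fin (D·n·n + r)` Boolean
  variables, `L(H) ≤ L(Q) + (D+n+3)^6 · C(2n,n)`, `deg H ≤ deg Q + (D+n+3)^5`:
  `H = rename ε (V · Q · ∏_k Sel_k)`, `V` the function-graph recogniser
  (`DatumWitness.valid_spec`), `Sel_k` the Lagrange selectors (`SelGadget.block_spec`).
* `SuccinctContraction.topEq_of_succinct` / `razAnn_of_succinct` — a NONZERO `F_Q` at scale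
  `N^c` (`D, r, L(Q), deg Q ≤ N^c`, `n ≥ 2`) vanishing on the top components of
  `SmallCircuits ℂ n b` (resp. on the image `razPoint n b` of Raz's map) is a level-`(6c+14)`
  top witness `TopEq(n, b, 6c+14)` (resp. Raz annihilator `RazAnn(n, b, 6c+14)`), in the shapes
  consumed by `TopEquations.eq_of_topEq` / `RazAnnihilators.definableEquations_of`.

This module is ROUTE-INDEPENDENT (no `Theses` import: it stays out of the route file's rebuild
cone); the crux-level corollaries (`definableEquations_of_succinctContractionEquation`,
`singleSizeEquations_of_succinctContractionEquation`, Raz form) are in the companion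
`…DefinableEquationsSuccinctContractionCrux.lean`.  They extend
`DefinableEquations_of_polyShortTableauEquation` (short lists = the case `r = ⌈log₂ k⌉`,
`Q = ∑_j [w = j] a_j Gsign_j`) to succinct sums of exponential length.  Reductions only: the crux
stays open (CT23 §1.3 dir. 2); nothing here bears on `VP ≠ VNP`.  No definitions, no named facts.
Refs: P. Bürgisser, *Completeness and Reduction in Algebraic Complexity Theory* (2000), Prop. 2.20,
Rem. 2.2; Bürgisser–Clausen–Shokrollahi 1997, Prop. (21.15), Lemma (21.22); P. Chatterjee,
A. Tengse, arXiv:2309.07612 §1.3.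
-/

set_option linter.dupNamespace false

noncomputable section

namespace Summit.ValiantsHypothesis.ValiantsHypothesis.Theorems.BarrierLeverDefinableEquations

open MvPolynomial Literature.Computability.AlgebraicComplexity
open Literature.Barriers.ValiantsHypothesis
open scoped BigOperators

namespace SuccinctContraction

/-! ### Boolean-point bookkeeping for the enlarged block `BPos D n ⊕ Fin r` -/

/-- Evaluating a lifted gadget (variables `Sum.map id Sum.inl`) at the Boolean point
`(u, w)` of the enlarged block ignores the auxiliary bits `w`. [folklore] -/
theorem aeval_boolPt_elim_rename_inl {σ β γ : Type*} (u : β → Bool) (w : γ → Bool)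
    (G : MvPolynomial (σ ⊕ β) ℂ) :
    aeval (boolPt (Sum.elim u w)) (rename (Sum.map id (Sum.inl : β → β ⊕ γ)) G) =
      aeval (boolPt u) G := by
  have h : (boolPt (σ := σ) (Sum.elim u w)) ∘ (Sum.map id (Sum.inl : β → β ⊕ γ)) =
      boolPt u := by
    funext x; rcases x with x | v <;> simp [boolPt]
  rw [aeval_rename, h]

/-- A sum over Boolean assignments of `α ⊕ β` is an iterated sum (`u = Sum.elim _ _`). [folklore] -/
theorem sum_boolAssign_sum {M : Type*} [AddCommMonoid M] {α β : Type*} [Fintype α] [Fintype β]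
    [DecidableEq α] [DecidableEq β] (F : (α ⊕ β → Bool) → M) :
    ∑ u : α ⊕ β → Bool, F u = ∑ u₁ : α → Bool, ∑ w : β → Bool, F (Sum.elim u₁ w) := by
  rw [← Fintype.sum_prod_type']
  exact Fintype.sum_equiv (Equiv.sumArrowEquivProdArrow α β Bool) _ _
    fun u => congrArg F (Sum.elim_comp_inl_inr u).symm

/-- The selector gadgets of `SelGadget.block_spec`, existentially (size `≤ (B+n+2)^4 · C(2n,n)`,
degree `≤ (B+n+2)^3`, value `X_{e(i|k)}` at the one-hot point of `i`). [folklore] -/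
theorem exists_selectors (n D B : ℕ) :
    ∃ G : Fin D → MvPolynomial (↥(topMonomials n) ⊕ BPos D n) ℂ, ∀ k : Fin D,
      complexity (G k) ≤ (B + n + 2) ^ 4 * Nat.choose (2 * n) n ∧
        (G k).totalDegree ≤ (B + n + 2) ^ 3 ∧
          ∀ i : Fin D × Fin n → Fin n,
            aeval (boolPt (oneHot i)) (G k) = X (expTop fun l => i (k, l)) := by
  classical
  letI : Fintype (topMonomials n) :=
    Fintype.ofFinset ((Finset.univ : Finset (Fin n)).finsuppAntidiag n)
      fun e => (degree_eq_iff_mem_finsuppAntidiag e n).symm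
  exact ⟨_, fun k => SelGadget.block_spec B k⟩

/-! ### The witness -/

/-- **Valiant's criterion at scale `N` for succinct contraction sums.**  For every `n, D, r` and
every `Q` on the top coefficient variables and the Boolean block `BPos D n ⊕ Fin r`, the succinct
contraction sum `F_Q = ∑_i ∑_w Q(X; oneHot i, w) · ∏_k X_{e(i|k)}` is `boolSum H` for an `H`
on `Fin (D·n·n + r)` Boolean variables with `L(H) ≤ L(Q) + (D+n+3)^6 · C(2n,n)` and
`deg H ≤ deg Q + (D+n+3)^5`.  Witness: `H = rename ε (V · Q · ∏_k Sel_k)`, `V` the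
function-graph recogniser (only one-hot `u` survive the Boolean sum), `Sel_k` the selectors.
[cite: Burgisser2000, Prop. 2.20] -/
theorem exists_witness (n D r : ℕ)
    (Q : MvPolynomial (↥(topMonomials n) ⊕ (BPos D n ⊕ Fin r)) ℂ) :
    ∃ H : MvPolynomial (↥(topMonomials n) ⊕ Fin (D * n * n + r)) ℂ,
      boolSum H = ∑ i : Fin D × Fin n → Fin n, ∑ w : Fin r → Bool,
          aeval (boolPt (Sum.elim (oneHot i) w)) Q * ∏ k : Fin D, X (expTop fun l => i (k, l)) ∧
      complexity H ≤ complexity Q + (D + n + 3) ^ 6 * Nat.choose (2 * n) n ∧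
      H.totalDegree ≤ Q.totalDegree + (D + n + 3) ^ 5 := by
  classical
  obtain ⟨V, hV_v, hV_c, hV_d⟩ := DatumWitness.valid_spec n D
  obtain ⟨Gx, hGx⟩ := exists_selectors n D (D + 1)
  set P : ℕ := D + n + 3 with hPdef
  set N : ℕ := Nat.choose (2 * n) n with hNdef
  have hPB : D + 1 + n + 2 = P := by omega
  have hP3 : 3 ≤ P := by omega
  have hP0 : 0 < P := by omega
  have hDP : D ≤ P := by omega
  have hnP : n ≤ P := by omega
  have hn1P : n + 1 ≤ P := by omega
  have hN1 : 1 ≤ N := Nat.choose_pos (by omega)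
  -- the lift into the enlarged Boolean block
  let lift : MvPolynomial (↥(topMonomials n) ⊕ BPos D n) ℂ →
      MvPolynomial (↥(topMonomials n) ⊕ (BPos D n ⊕ Fin r)) ℂ :=
    fun G => rename (Sum.map id (Sum.inl : BPos D n → BPos D n ⊕ Fin r)) G
  let ε : BPos D n ⊕ Fin r ≃ Fin (D * n * n + r) :=
    (Equiv.sumCongr ((Equiv.prodCongr finProdFinEquiv (Equiv.refl (Fin n))).trans finProdFinEquiv)
      (Equiv.refl (Fin r))).trans finSumFinEquiv
  refine ⟨rename (Sum.map id ε) (lift V * Q * ∏ k, lift (Gx k)), ?_, ?_, ?_⟩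
  · -- the Boolean sum
    rw [DatumWitness.boolSum_rename_eq, sum_boolAssign_sum]
    calc ∑ u₁ : BPos D n → Bool, ∑ w : Fin r → Bool,
          aeval (boolPt (Sum.elim u₁ w)) (lift V * Q * ∏ k, lift (Gx k))
        = ∑ u₁ : BPos D n → Bool, aeval (boolPt u₁) V *
            ∑ w : Fin r → Bool, (aeval (boolPt (Sum.elim u₁ w)) Q *
              ∏ k, aeval (boolPt u₁) (Gx k)) := by
          refine Finset.sum_congr rfl fun u₁ _ => ?_
          rw [Finset.mul_sum]
          refine Finset.sum_congr rfl fun w _ => ?_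
          rw [map_mul, map_mul, map_prod, aeval_boolPt_elim_rename_inl]
          simp only [lift, aeval_boolPt_elim_rename_inl]
          ring
      _ = ∑ i : Fin D × Fin n → Fin n, ∑ w : Fin r → Bool,
            (aeval (boolPt (Sum.elim (oneHot i) w)) Q *
              ∏ k, aeval (boolPt (oneHot i)) (Gx k)) :=
          hV_v fun u₁ => ∑ w : Fin r → Bool, (aeval (boolPt (Sum.elim u₁ w)) Q *
              ∏ k, aeval (boolPt u₁) (Gx k))
      _ = _ := by
          refine Finset.sum_congr rfl fun i _ => Finset.sum_congr rfl fun w _ => ?_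
          rw [Finset.prod_congr rfl fun k _ => (hGx k).2.2 i]
  · -- the size
    refine (complexity_rename_le_holds' _ _).trans ?_
    have c1 := complexity_mul_le_holds (lift V * Q) (∏ k, lift (Gx k))
    have c2 := complexity_mul_le_holds (lift V) Q
    have cV : complexity (lift V) ≤ P ^ 5 := by
      refine (complexity_rename_le_holds' _ _).trans (hV_c.trans ?_)
      calc 3 * (D * n * (n + 1) ^ 2) ≤ 3 * (P * P * P ^ 2) := by gcongr
        _ = 3 * P ^ 4 := by ring
        _ ≤ P * P ^ 4 := Nat.mul_le_mul_right _ hP3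
        _ = P ^ 5 := by ring
    have cG : complexity (∏ k, lift (Gx k)) ≤ P ^ 5 * N + P := by
      calc complexity (∏ k, lift (Gx k))
          ≤ (Finset.univ : Finset (Fin D)).card * (P ^ 4 * N) +
              (Finset.univ : Finset (Fin D)).card :=
            complexity_prod_le_of_le _ _ _ fun k _ =>
              (complexity_rename_le_holds' _ _).trans (by rw [← hPB]; exact (hGx k).1)
        _ = D * (P ^ 4 * N) + D := by rw [Finset.card_univ, Fintype.card_fin]
        _ ≤ P * (P ^ 4 * N) + P := by gcongr
        _ = P ^ 5 * N + P := by ring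
    have f1 : P + 2 ≤ P ^ 5 := by
      calc P + 2 ≤ 3 * P := by omega
        _ ≤ P * P := Nat.mul_le_mul_right _ hP3
        _ = P ^ 2 := (sq P).symm
        _ ≤ P ^ 5 := Nat.pow_le_pow_right hP0 (by norm_num)
    have f2 : P ^ 5 ≤ P ^ 5 * N := Nat.le_mul_of_pos_right _ hN1
    have f3 : 3 * (P ^ 5 * N) ≤ P ^ 6 * N := by
      calc 3 * (P ^ 5 * N) ≤ P * (P ^ 5 * N) := Nat.mul_le_mul_right _ hP3
        _ = P ^ 6 * N := by ring
    omega
  · -- the degree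
    refine (totalDegree_rename_le _ _).trans ?_
    have d1 := totalDegree_mul (lift V * Q) (∏ k, lift (Gx k))
    have d2 := totalDegree_mul (lift V) Q
    have dV : (lift V).totalDegree ≤ P ^ 3 := by
      refine (totalDegree_rename_le _ _).trans (hV_d.trans ?_)
      calc D * n * (n + 1) ≤ P * P * P := by gcongr
        _ = P ^ 3 := by ring
    have dG : (∏ k, lift (Gx k)).totalDegree ≤ P ^ 4 := by
      calc (∏ k, lift (Gx k)).totalDegree
          ≤ (Finset.univ : Finset (Fin D)).card * P ^ 3 :=
            totalDegree_prod_le_of_le _ _ _ fun k _ =>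
              (totalDegree_rename_le _ _).trans (by rw [← hPB]; exact (hGx k).2.1)
        _ = D * P ^ 3 := by rw [Finset.card_univ, Fintype.card_fin]
        _ ≤ P * P ^ 3 := by gcongr
        _ = P ^ 4 := by ring
    have f1 : P ^ 3 ≤ P ^ 4 := Nat.pow_le_pow_right hP0 (by norm_num)
    have f2 : 2 * P ^ 4 ≤ P ^ 5 := by
      calc 2 * P ^ 4 ≤ P * P ^ 4 := Nat.mul_le_mul_right _ (by omega)
        _ = P ^ 5 := by ring
    omega

/-! ### Scale-`N^c` arithmetic -/

/-- Level arithmetic: at scale `N^c` the witness of `exists_witness` has level `6c + 14`.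
[folklore] -/
theorem level_arith {n c D r L d : ℕ} (hn : 2 ≤ n) (hD : D ≤ (Nat.choose (2 * n) n) ^ c)
    (hr : r ≤ (Nat.choose (2 * n) n) ^ c) (hL : L ≤ (Nat.choose (2 * n) n) ^ c)
    (hd : d ≤ (Nat.choose (2 * n) n) ^ c) :
    D * n * n + r ≤ (Nat.choose (2 * n) n) ^ (6 * c + 14) ∧
      L + (D + n + 3) ^ 6 * Nat.choose (2 * n) n ≤ (Nat.choose (2 * n) n) ^ (6 * c + 14) ∧
        d + (D + n + 3) ^ 5 ≤ (Nat.choose (2 * n) n) ^ (6 * c + 14) := by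
  set N : ℕ := Nat.choose (2 * n) n with hNdef
  have hnN : 2 * n ≤ N := by
    -- `C(2n, 1) ≤ C(2n, n)` (as in `two_mul_le_centralChoose`, whose module imports the route file)
    have h := Nat.choose_le_middle 1 (2 * n)
    rwa [Nat.choose_one_right, Nat.mul_div_cancel_left n Nat.two_pos] at h
  have hN3 : 3 ≤ N := by omega
  have hN0 : 0 < N := by omega
  have hmono : ∀ {i j : ℕ}, i ≤ j → N ^ i ≤ N ^ j := fun h => Nat.pow_le_pow_right hN0 h
  have hcN : N ^ c ≤ N ^ (c + 1) := hmono (by omega)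
  have h1N : N ≤ N ^ (c + 1) := by
    calc N = N ^ 1 := (pow_one N).symm
      _ ≤ N ^ (c + 1) := hmono (by omega)
  -- `D + n + 3 ≤ N^(c+2)`
  have hP : D + n + 3 ≤ N ^ (c + 2) := by
    calc D + n + 3 ≤ N ^ c + N + N := by omega
      _ ≤ N ^ (c + 1) + N ^ (c + 1) + N ^ (c + 1) := by omega
      _ = 3 * N ^ (c + 1) := by ring
      _ ≤ N * N ^ (c + 1) := Nat.mul_le_mul_right _ hN3
      _ = N ^ (c + 2) := by ring
  have hP6 : (D + n + 3) ^ 6 * N ≤ N ^ (6 * c + 13) := by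
    calc (D + n + 3) ^ 6 * N ≤ (N ^ (c + 2)) ^ 6 * N := by gcongr
      _ = N ^ (6 * c + 13) := by ring
  have hP5 : (D + n + 3) ^ 5 ≤ N ^ (6 * c + 13) := by
    calc (D + n + 3) ^ 5 ≤ (N ^ (c + 2)) ^ 5 := by gcongr
      _ = N ^ (5 * c + 10) := by ring
      _ ≤ N ^ (6 * c + 13) := hmono (by omega)
  have hc13 : N ^ c ≤ N ^ (6 * c + 13) := hmono (by omega)
  have htop : 2 * N ^ (6 * c + 13) ≤ N ^ (6 * c + 14) := by
    calc 2 * N ^ (6 * c + 13) ≤ N * N ^ (6 * c + 13) := Nat.mul_le_mul_right _ (by omega)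
      _ = N ^ (6 * c + 14) := by ring
  have hq : D * n * n + r ≤ N ^ (6 * c + 14) := by
    calc D * n * n + r ≤ N ^ c * N * N + N ^ c := by gcongr <;> omega
      _ = N ^ (c + 2) + N ^ c := by ring
      _ ≤ N ^ (6 * c + 13) + N ^ (6 * c + 13) := Nat.add_le_add (hmono (by omega)) hc13
      _ = 2 * N ^ (6 * c + 13) := by ring
      _ ≤ N ^ (6 * c + 14) := htop
  refine ⟨hq, ?_, ?_⟩
  · calc L + (D + n + 3) ^ 6 * N ≤ N ^ (6 * c + 13) + N ^ (6 * c + 13) :=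
          Nat.add_le_add (hL.trans hc13) hP6
      _ = 2 * N ^ (6 * c + 13) := by ring
      _ ≤ N ^ (6 * c + 14) := htop
  · calc d + (D + n + 3) ^ 5 ≤ N ^ (6 * c + 13) + N ^ (6 * c + 13) :=
          Nat.add_le_add (hd.trans hc13) hP5
      _ = 2 * N ^ (6 * c + 13) := by ring
      _ ≤ N ^ (6 * c + 14) := htop

/-! ### Succinct equations ⇒ the crux's witnesses -/

/-- **Succinct top equation ⇒ `TopEq(n, b, 6c+14)`** (`n ≥ 2`): a nonzero succinct contraction
sum at scale `N^c` vanishing at the top homogeneous component of every `f ∈ SmallCircuits ℂ n b`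
is (the Boolean sum of) a level-`(6c+14)` top witness. [cite: Burgisser2000, Prop. 2.20] -/
theorem topEq_of_succinct {c b n : ℕ} (hn : 2 ≤ n)
    (h : ∃ D r : ℕ, D ≤ (Nat.choose (2 * n) n) ^ c ∧ r ≤ (Nat.choose (2 * n) n) ^ c ∧
      ∃ Q : MvPolynomial (↥(topMonomials n) ⊕ (BPos D n ⊕ Fin r)) ℂ,
        complexity Q ≤ (Nat.choose (2 * n) n) ^ c ∧
        Q.totalDegree ≤ (Nat.choose (2 * n) n) ^ c ∧
        (∑ i : Fin D × Fin n → Fin n, ∑ w : Fin r → Bool,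
            aeval (boolPt (Sum.elim (oneHot i) w)) Q * ∏ k : Fin D, X (expTop fun l => i (k, l)))
          ≠ 0 ∧
        ∀ f ∈ SmallCircuits ℂ n b,
          eval (fun e : topMonomials n => coeff (e : Fin n →₀ ℕ) f)
            (∑ i : Fin D × Fin n → Fin n, ∑ w : Fin r → Bool,
              aeval (boolPt (Sum.elim (oneHot i) w)) Q *
                ∏ k : Fin D, X (expTop fun l => i (k, l))) = 0) :
    ∃ q : ℕ, q ≤ (Nat.choose (2 * n) n) ^ (6 * c + 14) ∧
      ∃ H : MvPolynomial (↥(topMonomials n) ⊕ Fin q) ℂ,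
        complexity H ≤ (Nat.choose (2 * n) n) ^ (6 * c + 14) ∧
        H.totalDegree ≤ (Nat.choose (2 * n) n) ^ (6 * c + 14) ∧
        boolSum H ≠ 0 ∧
        ∀ f ∈ SmallCircuits ℂ n b,
          eval (fun e : topMonomials n => coeff (e : Fin n →₀ ℕ) f) (boolSum H) = 0 := by
  obtain ⟨D, r, hD, hr, Q, hQc, hQd, hne, hvan⟩ := h
  obtain ⟨H, hsum, hHc, hHd⟩ := exists_witness n D r Q
  obtain ⟨hq, hL, hd⟩ := level_arith hn hD hr hQc hQd
  refine ⟨D * n * n + r, hq, H, hHc.trans hL, hHd.trans hd, ?_, fun f hf => ?_⟩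
  · rw [hsum]; exact hne
  · rw [hsum]; exact hvan f hf

/-- **Succinct Raz equation ⇒ `RazAnn(n, b, 6c+14)`** (`n ≥ 2`): a nonzero succinct contraction
sum at scale `N^c` vanishing on the whole image `razPoint n b` of Raz's universal-circuit map is
(the Boolean sum of) a level-`(6c+14)` annihilator. [cite: Burgisser2000, Prop. 2.20] -/
theorem razAnn_of_succinct {c b n : ℕ} (hn : 2 ≤ n)
    (h : ∃ D r : ℕ, D ≤ (Nat.choose (2 * n) n) ^ c ∧ r ≤ (Nat.choose (2 * n) n) ^ c ∧
      ∃ Q : MvPolynomial (↥(topMonomials n) ⊕ (BPos D n ⊕ Fin r)) ℂ,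
        complexity Q ≤ (Nat.choose (2 * n) n) ^ c ∧
        Q.totalDegree ≤ (Nat.choose (2 * n) n) ^ c ∧
        (∑ i : Fin D × Fin n → Fin n, ∑ w : Fin r → Bool,
            aeval (boolPt (Sum.elim (oneHot i) w)) Q * ∏ k : Fin D, X (expTop fun l => i (k, l)))
          ≠ 0 ∧
        ∀ y : RazUniversal.Lab (Fin n) n (razSlots n b) → ℂ,
          eval (razPoint n b y)
            (∑ i : Fin D × Fin n → Fin n, ∑ w : Fin r → Bool,
              aeval (boolPt (Sum.elim (oneHot i) w)) Q *
                ∏ k : Fin D, X (expTop fun l => i (k, l))) = 0) :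
    ∃ q : ℕ, q ≤ (Nat.choose (2 * n) n) ^ (6 * c + 14) ∧
      ∃ H : MvPolynomial (↥(topMonomials n) ⊕ Fin q) ℂ,
        complexity H ≤ (Nat.choose (2 * n) n) ^ (6 * c + 14) ∧
        H.totalDegree ≤ (Nat.choose (2 * n) n) ^ (6 * c + 14) ∧
        boolSum H ≠ 0 ∧
        ∀ y : RazUniversal.Lab (Fin n) n (razSlots n b) → ℂ,
          eval (razPoint n b y) (boolSum H) = 0 := by
  obtain ⟨D, r, hD, hr, Q, hQc, hQd, hne, hvan⟩ := h
  obtain ⟨H, hsum, hHc, hHd⟩ := exists_witness n D r Q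
  obtain ⟨hq, hL, hd⟩ := level_arith hn hD hr hQc hQd
  refine ⟨D * n * n + r, hq, H, hHc.trans hL, hHd.trans hd, ?_, fun y => ?_⟩
  · rw [hsum]; exact hne
  · rw [hsum]; exact hvan y

end SuccinctContraction

end Summit.ValiantsHypothesis.ValiantsHypothesis.Theorems.BarrierLeverDefinableEquations

end
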